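import Summits.CriticalPhenomena.PercolationContinuityZ3.Theorems.PercNearOneGluingNoHeavyQuantCountDP
import HarnessLib

/-!
# FAR beyond trees: the DEFICIT fixed-set FAR inequality at layer two — `P(N ≥ 3) ≥ η·(E N − 2)/2` for independent trials with
# success probabilities in `[η, 1]` and mean `E N ≤ 4`

builds on p205010 (kernel theorem, internal audit signed; external expert review pending)

Support file (`--supports stmt-CriticalPhenomena-4575`), seat `prim-cert-1` (gen 35); memo `prim-cert-1/FROM-prim-cert-1-g35-FRAME-COVERING.md` §2.
This is inequality **(D)** of `prim-cert-1/FROM-prim-cert-1-g34-UNIVERSAL-WITNESS.md` §3 at `j = 2`: the short-row half of THM B there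
("the weakest-hair bet `W(μ_W)` is a hair-only certificate for `SunFAR K 2` whenever `η(Σh − 4) ≤ 2(F − η)`"), whose long-row half is LEMMA L.
Same local notation `PB[p, m] b` as `…QuantCountDP.lean` (probability that exactly `b` of the first `m` independent trials succeed; pure real
algebra on the recursion, no measure theory, no definitions, no sorries, standard axioms).

* `Quant.CountDP.cdf_eq_one_of_lt` / `cdf_le_one` / `tail_succ_succ` / `tail_le_tail_succ` — bookkeeping for the tails `1 − Σ_{i<a} PB[p, m] i`.
* `Quant.CountDP.tail_nbu` — **NBU** ("new better than used") for the success count: `P(S_m ≥ a + t) ≤ P(S_m ≥ a)·P(S_m ≥ t)`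
  (induction on `m` through the tail recursion).
* `Quant.CountDP.sum_tail_eq_mean` — `Σ_{a<m} P(S_m ≥ a+1) = Σ_{k<m} p k`;  `Quant.CountDP.sum_sq_dev` — for every real `c`,
  `Σ_b (c − b)² PB[p, m] b = (c − Σ_{k<m} p k)² + Σ_{k<m} p k (1 − p k)` (mean and variance of the count, in one identity).
* **`Quant.CountDP.deficit_far_two`** — for `0 < η`, `η ≤ p k ≤ 1` (`k < m`) and `Σ_{k<m} p k ≤ 4`:
  `η·(Σ_{k<m} p k − 2)/2 ≤ 1 − Σ_{i<3} PB[p, m] i`.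
  Proof (`s := Σ p − 2`): (a) `s ≥ 1/3`: Cantelli — `P(S ≤ 2)(s+u)² ≤ E(E S + u − S)² = u² + Var S ≤ u² + (1−η)(s+2)` with `u = (1−η)(s+2)/s`,
  and `2s − ηs² − η(1−η)(2+s) ≥ 0` on `[1/3, 2]`; (b) `s < 1/3`, `η ≤ 3/5`: NBU gives `Σ_{a≥4} P(S ≥ a) ≤ P(S ≥ 3)·E S`, and
  `Σ_{a≥3} P(S ≥ a) ≥ E S − 2`, so `s ≤ P(S ≥ 3)(3 + s)`; (c) `s < 1/3`, `η > 3/5`: then `m = 3` and `P(S = 3) = p₀p₁p₂ ≥ p₀+p₁+p₂−2 = s`.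
Numerical re-check of every displayed inequality (45 000 random instances, equality approached only at `η → 1`, `Σ p → 4`, `m = 4`):
seat folder `work/py` (memo §2).  Nearest prior art: Cantelli's inequality and the NBU property of sums of independent indicators are folklore;
the packaged statement is [this work].
-/

noncomputable section

namespace Summit.CriticalPhenomena.PercolationContinuityZ3.Theorems

namespace Quant

namespace CountDP

open Finset

/-- `PB[p, m] b` = probability that exactly `b` of the first `m` independent trials succeed (recursion on `m`, as in `…QuantCountDP.lean`). -/
local notation3 "PB[" p ", " m "]" =>
  (Nat.rec (motive := fun _ => ℕ → ℝ) (fun b => if b = 0 then (1 : ℝ) else 0)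
    (fun n f b => (p : ℕ → ℝ) n * (if b = 0 then (0 : ℝ) else f (b - 1)) + (1 - (p : ℕ → ℝ) n) * f b) (m : ℕ))

variable (p : ℕ → ℝ)

/-! ### Tails: bookkeeping -/

/-- Beyond the horizon the cdf is one: `Σ_{i<a} PB[p, m] i = 1` for `a > m`. [folklore] -/
theorem cdf_eq_one_of_lt (m a : ℕ) (h : m < a) : ∑ i ∈ Finset.range a, PB[p, m] i = 1 := by
  rw [← Finset.sum_range_add_sum_Ico (fun i => PB[p, m] i) (show m + 1 ≤ a by omega), PB_sum_eq_one]
  have : ∑ i ∈ Finset.Ico (m + 1) a, PB[p, m] i = 0 :=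
    Finset.sum_eq_zero fun i hi => PB_eq_zero_of_lt p m i (by rw [Finset.mem_Ico] at hi; omega)
  rw [this, add_zero]

/-- The cdf is at most one. [folklore] -/
theorem cdf_le_one (hp : ∀ k, 0 ≤ p k ∧ p k ≤ 1) (m a : ℕ) : ∑ i ∈ Finset.range a, PB[p, m] i ≤ 1 := by
  rcases Nat.lt_or_ge m a with h | h
  · rw [cdf_eq_one_of_lt p m a h]
  · calc ∑ i ∈ Finset.range a, PB[p, m] i ≤ ∑ i ∈ Finset.range (m + 1), PB[p, m] i :=
          Finset.sum_le_sum_of_subset_of_nonneg (Finset.range_mono (by omega)) fun i _ _ => PB_nonneg p hp m i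
      _ = 1 := PB_sum_eq_one p m

/-- The cdf is nonnegative. [folklore] -/
theorem cdf_nonneg (hp : ∀ k, 0 ≤ p k ∧ p k ≤ 1) (m a : ℕ) : 0 ≤ ∑ i ∈ Finset.range a, PB[p, m] i :=
  Finset.sum_nonneg fun i _ => PB_nonneg p hp m i

/-- **Tail recursion**: `P(S_{m+1} ≥ a+1) = p m · P(S_m ≥ a) + (1 − p m) · P(S_m ≥ a+1)`. [folklore] -/
theorem tail_succ_succ (m a : ℕ) :
    1 - ∑ i ∈ Finset.range (a + 1), PB[p, m + 1] i =
      p m * (1 - ∑ i ∈ Finset.range a, PB[p, m] i) + (1 - p m) * (1 - ∑ i ∈ Finset.range (a + 1), PB[p, m] i) := by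
  rw [cdf_succ, Finset.sum_range_succ]
  ring

/-- One more trial can only raise a tail: `P(S_m ≥ a) ≤ P(S_{m+1} ≥ a)`. [folklore] -/
theorem tail_le_tail_succ (hp : ∀ k, 0 ≤ p k ∧ p k ≤ 1) (m a : ℕ) :
    1 - ∑ i ∈ Finset.range a, PB[p, m] i ≤ 1 - ∑ i ∈ Finset.range a, PB[p, m + 1] i := by
  cases a with
  | zero => simp
  | succ a =>
    rw [cdf_succ]
    have := mul_nonneg (hp m).1 (PB_nonneg p hp m a)
    linarith

/-! ### NBU -/

/-- **NBU for the success count**: `P(S_m ≥ a + t) ≤ P(S_m ≥ a) · P(S_m ≥ t)` — having reached `a` successes, at least `t` FURTHER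
successes are needed, and the remaining trials are a sub-family. (Induction on `m` through `tail_succ_succ`.) [folklore] -/
theorem tail_nbu (hp : ∀ k, 0 ≤ p k ∧ p k ≤ 1) (m : ℕ) : ∀ a t : ℕ,
    1 - ∑ i ∈ Finset.range (a + t), PB[p, m] i ≤
      (1 - ∑ i ∈ Finset.range a, PB[p, m] i) * (1 - ∑ i ∈ Finset.range t, PB[p, m] i) := by
  induction m with
  | zero =>
    intro a t
    cases a with
    | zero => simp
    | succ a =>
      rw [cdf_eq_one_of_lt p 0 (a + 1 + t) (by omega), sub_self]
      exact mul_nonneg (by linarith [cdf_le_one p hp 0 (a + 1)]) (by linarith [cdf_le_one p hp 0 t])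
  | succ m ih =>
    intro a t
    cases a with
    | zero => simp
    | succ a =>
      cases t with
      | zero => simp
      | succ t =>
        have e1 : a + 1 + (t + 1) = (a + (t + 1)) + 1 := by omega
        rw [e1, tail_succ_succ p m (a + (t + 1)), tail_succ_succ p m a]
        have h1 := ih a (t + 1)
        have h2 := ih (a + 1) (t + 1)
        have e2 : a + 1 + (t + 1) = a + (t + 1) + 1 := by omega
        rw [e2] at h2
        have h3 := tail_le_tail_succ p hp m (t + 1)
        have hA0 : 0 ≤ 1 - ∑ i ∈ Finset.range a, PB[p, m] i := by linarith [cdf_le_one p hp m a]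
        have hA1 : 0 ≤ 1 - ∑ i ∈ Finset.range (a + 1), PB[p, m] i := by linarith [cdf_le_one p hp m (a + 1)]
        have hT : 0 ≤ 1 - ∑ i ∈ Finset.range (t + 1), PB[p, m] i := by linarith [cdf_le_one p hp m (t + 1)]
        have hpm := hp m
        -- `p·T(a+t+1) + q·T(a+t+2) ≤ (p·T(a) + q·T(a+1))·T_m(t+1) ≤ (…)·T_{m+1}(t+1)`
        have step1 : p m * (1 - ∑ i ∈ Finset.range (a + (t + 1)), PB[p, m] i) ≤
            p m * ((1 - ∑ i ∈ Finset.range a, PB[p, m] i) * (1 - ∑ i ∈ Finset.range (t + 1), PB[p, m] i)) :=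
          mul_le_mul_of_nonneg_left h1 hpm.1
        have step2 : (1 - p m) * (1 - ∑ i ∈ Finset.range (a + (t + 1) + 1), PB[p, m] i) ≤
            (1 - p m) * ((1 - ∑ i ∈ Finset.range (a + 1), PB[p, m] i) * (1 - ∑ i ∈ Finset.range (t + 1), PB[p, m] i)) :=
          mul_le_mul_of_nonneg_left h2 (by linarith)
        have step3 : (p m * (1 - ∑ i ∈ Finset.range a, PB[p, m] i) +
              (1 - p m) * (1 - ∑ i ∈ Finset.range (a + 1), PB[p, m] i)) * (1 - ∑ i ∈ Finset.range (t + 1), PB[p, m] i) ≤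
            (p m * (1 - ∑ i ∈ Finset.range a, PB[p, m] i) +
              (1 - p m) * (1 - ∑ i ∈ Finset.range (a + 1), PB[p, m] i)) * (1 - ∑ i ∈ Finset.range (t + 1), PB[p, m + 1] i) :=
          mul_le_mul_of_nonneg_left h3 (add_nonneg (mul_nonneg hpm.1 hA0) (mul_nonneg (by linarith) hA1))
        linarith

/-! ### Mean and second moment -/

/-- **Mean as a tail sum**: `Σ_{a<m} P(S_m ≥ a+1) = Σ_{k<m} p k`. [folklore] -/
theorem sum_tail_eq_mean (m : ℕ) :
    ∑ a ∈ Finset.range m, (1 - ∑ i ∈ Finset.range (a + 1), PB[p, m] i) = ∑ k ∈ Finset.range m, p k := by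
  induction m with
  | zero => simp
  | succ m ih =>
    have h1 : ∀ a, 1 - ∑ i ∈ Finset.range (a + 1), PB[p, m + 1] i =
        (1 - ∑ i ∈ Finset.range (a + 1), PB[p, m] i) + p m * PB[p, m] a := by
      intro a; rw [cdf_succ]; ring
    simp_rw [h1]
    rw [Finset.sum_add_distrib, Finset.sum_range_succ (fun a => 1 - ∑ i ∈ Finset.range (a + 1), PB[p, m] i) m, ih,
      ← Finset.mul_sum, PB_sum_eq_one, Finset.sum_range_succ p m]
    ring

/-- **Squared deviation from any centre**: `Σ_{b ≤ m} (c − b)² PB[p, m] b = (c − Σ_{k<m} p k)² + Σ_{k<m} p k (1 − p k)` for every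
real `c` (mean `Σ p k` and variance `Σ p k (1 − p k)` of the count in one identity). [folklore] -/
theorem sum_sq_dev (m : ℕ) : ∀ c : ℝ,
    ∑ b ∈ Finset.range (m + 1), (c - b) ^ 2 * PB[p, m] b =
      (c - ∑ k ∈ Finset.range m, p k) ^ 2 + ∑ k ∈ Finset.range m, p k * (1 - p k) := by
  induction m with
  | zero => intro c; simp
  | succ m ih =>
    intro c
    -- split `PB[p, m+1] b = p m · [b ≠ 0] PB[p, m] (b−1) + (1 − p m) · PB[p, m] b` and shift the first sum
    have hsplit : ∑ b ∈ Finset.range (m + 2), (c - b) ^ 2 * PB[p, m + 1] b =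
        p m * ∑ b ∈ Finset.range (m + 1), (c - 1 - b) ^ 2 * PB[p, m] b +
          (1 - p m) * ∑ b ∈ Finset.range (m + 1), (c - b) ^ 2 * PB[p, m] b := by
      have e1 : ∑ b ∈ Finset.range (m + 2), (c - b) ^ 2 * PB[p, m + 1] b =
          ∑ b ∈ Finset.range (m + 2), ((c - b) ^ 2 * (p m * (if b = 0 then (0 : ℝ) else PB[p, m] (b - 1))) +
            (c - b) ^ 2 * ((1 - p m) * PB[p, m] b)) :=
        Finset.sum_congr rfl fun b _ => by rw [PB_succ]; ring
      rw [e1, Finset.sum_add_distrib]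
      congr 1
      · rw [Finset.sum_range_succ', Finset.mul_sum]
        simp only [if_true, mul_zero, add_zero, Nat.add_one_ne_zero, if_false, Nat.add_sub_cancel]
        refine Finset.sum_congr rfl fun b _ => ?_
        push_cast
        ring
      · rw [Finset.sum_range_succ, PB_eq_zero_of_lt p m (m + 1) (by omega), mul_zero, mul_zero, add_zero, Finset.mul_sum]
        refine Finset.sum_congr rfl fun b _ => ?_
        ring
    rw [hsplit, ih (c - 1), ih c, Finset.sum_range_succ, Finset.sum_range_succ]
    ring

/-! ### The deficit inequality -/

/-- Three trials: `P(S_3 = 3) = p 0 · p 1 · p 2` and `Σ_{i<3} PB[p, 3] i = 1 − p 0 p 1 p 2`. [folklore] -/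
theorem cdf_three_three : ∑ i ∈ Finset.range 3, PB[p, 3] i = 1 - p 0 * p 1 * p 2 := by
  have h1 : PB[p, 3] 3 = p 0 * p 1 * p 2 := by
    rw [show (3 : ℕ) = 2 + 1 by rfl, PB_succ_succ, PB_eq_zero_of_lt p 2 3 (by omega),
      show (2 : ℕ) = 1 + 1 by rfl, PB_succ_succ, PB_eq_zero_of_lt p 1 2 (by omega),
      show (1 : ℕ) = 0 + 1 by rfl, PB_succ_succ, PB_zero_zero, PB_zero_succ]
    ring
  have h2 := PB_sum_eq_one p 3
  rw [Finset.sum_range_succ, h1] at h2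
  linarith

/-- **THE DEFICIT FIXED-SET FAR INEQUALITY AT LAYER TWO.**  For independent trials with success probabilities `η ≤ p k ≤ 1` (`k < m`,
`η > 0`) and mean `Σ_{k<m} p k ≤ 4`:  `η · (Σ_{k<m} p k − 2)/2 ≤ P(S_m ≥ 3) = 1 − Σ_{i<3} PB[p, m] i`
(linear interpolation between `0` at mean `2` and the fixed-set FAR value `η` at mean `4`). [this work] -/
theorem deficit_far_two (hp : ∀ k, 0 ≤ p k ∧ p k ≤ 1) {η : ℝ} (hη0 : 0 < η) {m : ℕ} (hη : ∀ k, k < m → η ≤ p k)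
    (hE4 : ∑ k ∈ Finset.range m, p k ≤ 4) :
    η * (∑ k ∈ Finset.range m, p k - 2) / 2 ≤ 1 - ∑ i ∈ Finset.range 3, PB[p, m] i := by
  set E := ∑ k ∈ Finset.range m, p k with hEdef
  set V := 1 - ∑ i ∈ Finset.range 3, PB[p, m] i with hVdef
  have hV0 : 0 ≤ V := by rw [hVdef]; linarith [cdf_le_one p hp m 3]
  have hη1 : m ≠ 0 → η ≤ 1 := fun hm => (hη 0 (Nat.pos_of_ne_zero hm)).trans (hp 0).2
  have hEm : E ≤ m := by
    rw [hEdef]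
    have := Finset.sum_le_sum (s := Finset.range m) (f := p) (g := fun _ => (1 : ℝ)) fun k _ => (hp k).2
    simpa using this
  have hEη : (m : ℝ) * η ≤ E := by
    rw [hEdef]
    have := Finset.sum_le_sum (s := Finset.range m) (f := fun _ => η) (g := p) fun k hk => hη k (Finset.mem_range.1 hk)
    simpa using this
  -- the trivial case `E ≤ 2`
  by_cases hs : E ≤ 2
  · have : η * (E - 2) / 2 ≤ 0 := by
      have := mul_nonpos_of_nonneg_of_nonpos hη0.le (show E - 2 ≤ 0 by linarith)
      linarith
    linarith
  push Not at hs
  -- now `m ≥ 3` (three trials carry mean at most `3`, two at most `2`)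
  have hm3 : 3 ≤ m := by
    by_contra h
    have : (m : ℝ) ≤ 2 := by exact_mod_cast (show m ≤ 2 by omega)
    linarith
  have hη1' : η ≤ 1 := hη1 (by omega)
  obtain ⟨n, rfl⟩ : ∃ n, m = n + 3 := ⟨m - 3, by omega⟩
  by_cases hsa : 1 / 3 ≤ E - 2
  · ----------------------------------------------------------------
    -- (a) Cantelli: `P(S ≤ 2)·(s+u)² ≤ u² + Var ≤ u² + (1−η)E`, `u = (1−η)E/s`
    ----------------------------------------------------------------
    set s := E - 2 with hsdef
    have hs0 : 0 < s := by linarith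
    set W := (1 - η) * E with hWdef
    have hW0 : 0 ≤ W := mul_nonneg (by linarith) (by linarith)
    -- variance bound `Σ p(1−p) ≤ (1−η)E`
    have hvar : ∑ k ∈ Finset.range (n + 3), p k * (1 - p k) ≤ W := by
      rw [hWdef, hEdef, Finset.mul_sum]
      exact Finset.sum_le_sum fun k hk => by
        have := hη k (Finset.mem_range.1 hk)
        nlinarith [(hp k).1]
    -- Markov step on the squares: for `b ≤ 2`, `(E + u − b)² ≥ (s + u)²`
    have hmarkov : ∀ u : ℝ, 0 ≤ u →
        (∑ i ∈ Finset.range 3, PB[p, n + 3] i) * (s + u) ^ 2 ≤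
          ∑ b ∈ Finset.range (n + 3 + 1), (E + u - b) ^ 2 * PB[p, n + 3] b := by
      intro u hu
      calc (∑ i ∈ Finset.range 3, PB[p, n + 3] i) * (s + u) ^ 2
          = ∑ i ∈ Finset.range 3, (s + u) ^ 2 * PB[p, n + 3] i := by rw [Finset.sum_mul]; exact Finset.sum_congr rfl fun i _ => by ring
        _ ≤ ∑ i ∈ Finset.range 3, (E + u - i) ^ 2 * PB[p, n + 3] i := by
            refine Finset.sum_le_sum fun i hi => mul_le_mul_of_nonneg_right ?_ (PB_nonneg p hp (n + 3) i)
            have hi2 : (i : ℝ) ≤ 2 := by exact_mod_cast (show i ≤ 2 by rw [Finset.mem_range] at hi; omega)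
            have h1 : s + u ≤ E + u - i := by rw [hsdef]; linarith
            exact pow_le_pow_left₀ (by linarith) h1 2
        _ ≤ ∑ b ∈ Finset.range (n + 3 + 1), (E + u - b) ^ 2 * PB[p, n + 3] b :=
            Finset.sum_le_sum_of_subset_of_nonneg (Finset.range_mono (by omega))
              fun b _ _ => mul_nonneg (sq_nonneg _) (PB_nonneg p hp (n + 3) b)
    -- evaluate the right side with `sum_sq_dev` at `c = E + u`: `u² + Var`
    have hcant : ∀ u : ℝ, 0 ≤ u → (∑ i ∈ Finset.range 3, PB[p, n + 3] i) * (s + u) ^ 2 ≤ u ^ 2 + W := by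
      intro u hu
      have h1 := hmarkov u hu
      rw [sum_sq_dev p (n + 3) (E + u), ← hEdef] at h1
      have e : (E + u - E) ^ 2 = u ^ 2 := by ring
      rw [e] at h1
      linarith
    -- choose `u = W/s`:  `C·(s² + W)²/s² ≤ W(W + s²)/s²`, i.e. `C·(s² + W) ≤ W`
    have hC := hcant (W / s) (div_nonneg hW0 hs0.le)
    set C := ∑ i ∈ Finset.range 3, PB[p, n + 3] i with hCdef
    have hC0 : 0 ≤ C := by rw [hCdef]; exact cdf_nonneg p hp (n + 3) 3
    have hkey : C * (s ^ 2 + W) ≤ W := by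
      have e1 : (s + W / s) ^ 2 = (s ^ 2 + W) ^ 2 / s ^ 2 := by field_simp
      have e2 : (W / s) ^ 2 + W = W * (s ^ 2 + W) / s ^ 2 := by field_simp; ring
      rw [e1, e2] at hC
      have hs2 : 0 < s ^ 2 := by positivity
      have hsw : 0 < s ^ 2 + W := by positivity
      have h3 : C * (s ^ 2 + W) ^ 2 ≤ W * (s ^ 2 + W) := by
        have := mul_le_mul_of_nonneg_right hC hs2.le
        rwa [mul_div_assoc', div_mul_cancel₀ _ hs2.ne', div_mul_cancel₀ _ hs2.ne'] at this
      nlinarith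
    -- hence `V = 1 − C ≥ s²/(s² + W)` and the polynomial inequality finishes
    have hpoly : η * s * (s ^ 2 + W) ≤ 2 * s ^ 2 := by
      -- `2s − ηs² − η(1−η)(2+s) = (3/5)[(2−s)(21η²−22η+6)/9 + (s−1/3)·4(1−η)²] + η(s−1/3)(2−s) ≥ 0` on `[1/3, 2]`
      have hs2 : s ≤ 2 := by rw [hsdef]; linarith
      have hWle : W ≤ (1 - η) * (s + 2) := by rw [hWdef, hsdef]; nlinarith
      have g : 0 ≤ 2 * s - η * s ^ 2 - η * ((1 - η) * (s + 2)) := by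
        nlinarith [mul_nonneg (show 0 ≤ 2 - s by linarith) (sq_nonneg (η - 11 / 21)),
          mul_nonneg (show 0 ≤ s - 1 / 3 by linarith) (sq_nonneg (1 - η)),
          mul_nonneg (mul_nonneg hη0.le (show 0 ≤ s - 1 / 3 by linarith)) (show 0 ≤ 2 - s by linarith)]
      nlinarith [mul_le_mul_of_nonneg_left hWle (mul_nonneg hη0.le hs0.le)]
    have hsw : 0 < s ^ 2 + W := by positivity
    -- `η s/2 ≤ s²/(s²+W) ≤ 1 − C`
    have h1 : η * s / 2 * (s ^ 2 + W) ≤ (1 - C) * (s ^ 2 + W) := by nlinarith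
    have h2 := le_of_mul_le_mul_right h1 hsw
    rw [hVdef]
    linarith
  · push Not at hsa
    by_cases hηb : η ≤ 3 / 5
    · ----------------------------------------------------------------
      -- (b) NBU–Markov: `s ≤ P(S ≥ 3)·(3 + s)`
      ----------------------------------------------------------------
      -- tails `T a := P(S ≥ a)`
      have hmean := sum_tail_eq_mean p (n + 3)
      rw [← hEdef] at hmean
      -- split the tail sum: `E = T1 + T2 + T3 + Σ_{x<n} T(x+4)`
      rw [show n + 3 = 3 + n by omega, Finset.sum_range_add] at hmean
      rw [show 3 + n = n + 3 by omega] at hmean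
      have hT1 : 1 - ∑ i ∈ Finset.range (0 + 1), PB[p, n + 3] i ≤ 1 := by linarith [cdf_nonneg p hp (n + 3) (0 + 1)]
      have hT2 : 1 - ∑ i ∈ Finset.range (1 + 1), PB[p, n + 3] i ≤ 1 := by linarith [cdf_nonneg p hp (n + 3) (1 + 1)]
      -- NBU on the far tail: `T(x+4) ≤ T3 · T(x+1)`
      have hfar : ∑ x ∈ Finset.range n, (1 - ∑ i ∈ Finset.range (3 + x + 1), PB[p, n + 3] i) ≤
          V * ∑ x ∈ Finset.range n, (1 - ∑ i ∈ Finset.range (x + 1), PB[p, n + 3] i) := by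
        rw [Finset.mul_sum]
        refine Finset.sum_le_sum fun x _ => ?_
        have := tail_nbu p hp (n + 3) 3 (x + 1)
        rw [show 3 + (x + 1) = 3 + x + 1 by omega] at this
        rw [hVdef]
        exact this
      -- the partial tail sum is at most the full one (= E)
      have hpart : ∑ x ∈ Finset.range n, (1 - ∑ i ∈ Finset.range (x + 1), PB[p, n + 3] i) ≤ E := by
        have hmean' := sum_tail_eq_mean p (n + 3)
        rw [← hEdef] at hmean'
        rw [← hmean']
        exact Finset.sum_le_sum_of_subset_of_nonneg (Finset.range_mono (by omega))
          fun x _ _ => by linarith [cdf_le_one p hp (n + 3) (x + 1)]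
      have hT3 : 1 - ∑ i ∈ Finset.range (2 + 1), PB[p, n + 3] i = V := by rw [hVdef]
      rw [Finset.sum_range_succ, Finset.sum_range_succ, Finset.sum_range_one, hT3] at hmean
      -- `E ≤ 2 + V + V·E`
      have hineq : E - 2 ≤ V * (3 + (E - 2)) := by nlinarith [mul_le_mul_of_nonneg_left hpart hV0]
      -- finish: `η(3+s) ≤ 2` since `s < 1/3`, `η ≤ 3/5`
      have hs0 : 0 < E - 2 := by linarith
      nlinarith [mul_le_mul (hηb) (show 3 + (E - 2) ≤ 10 / 3 by linarith) (by linarith) (by norm_num : (0 : ℝ) ≤ 3 / 5)]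
    · ----------------------------------------------------------------
      -- (c) `η > 3/5`, `s < 1/3`: then `m = 3` and `P(S = 3) = p₀p₁p₂ ≥ p₀ + p₁ + p₂ − 2`
      ----------------------------------------------------------------
      push Not at hηb
      have hn : n = 0 := by
        by_contra h
        have : (4 : ℝ) ≤ ((n + 3 : ℕ) : ℝ) := by exact_mod_cast (show 4 ≤ n + 3 by omega)
        nlinarith
      subst hn
      have hC3 : ∑ i ∈ Finset.range 3, PB[p, 0 + 3] i = 1 - p 0 * p 1 * p 2 := cdf_three_three p
      have hV3 : V = p 0 * p 1 * p 2 := by rw [hVdef, hC3]; ring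
      have hE3 : E = p 0 + p 1 + p 2 := by
        rw [hEdef]; simp [Finset.sum_range_succ]
      have h0 := hp 0; have h1 := hp 1; have h2 := hp 2
      have hprod : p 0 + p 1 + p 2 - 2 ≤ p 0 * p 1 * p 2 := by
        nlinarith [mul_nonneg (sub_nonneg.2 h0.2) (sub_nonneg.2 h1.2),
          mul_nonneg (sub_nonneg.2 h2.2) (show 0 ≤ 1 - p 0 * p 1 by nlinarith)]
      rw [hV3, hE3]
      nlinarith

end CountDP

end Quant

end Summit.CriticalPhenomena.PercolationContinuityZ3.Theorems

end
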